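import Summits.Ventures.PercRepro.C041SeedCoverTailNine
import Summits.Ventures.PercRepro.C041SeedCoverHalfFull
import Summits.Ventures.PercRepro.C041SeedBridgeBox0
import Summits.Ventures.PercRepro.C041SeedBridgeBox1
import Summits.Ventures.PercRepro.C041SeedBridgeBox2
import Summits.Ventures.PercRepro.C041SeedBridgeBox3a
import Summits.Ventures.PercRepro.C041SeedBridgeCrown

/-!
# THE LAST SEED — THE STATE OF RECORD (mine-3, gen 65; C-041.md §21 (az))

The theorems of the last seed `θ_△(v 1, V a) ∈ cone` assembled: the crown `A ≥ 1/2` (C041SeedCoverCrown), the tails `P₁ ≥ 16`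
(C041SeedCoverTail), `P₁ ≥ 10` (C041SeedCoverTailTen) and `P₁ ≥ 9` (C041SeedCoverTailNine) for `A ≤ 1/2`, the bridge `9/2 ≤ P₁ ≤ 9`, `A ≤ 1/2`, `B ≤ 1/20`
(the bridge boxes 0, 1, 2, 3a and the crown certificate on `A ∈ [3/10, 1/2]`, `P₁ ∈ [8, 10]`), and the half-square `A, B ≤ 1/2`, `P₁ ≤ 9/2` with `P₁ ≥ 6/5` only for `A ≤ 1/20` (C041SeedCoverHalfFull):
* `InCone_thetaTri_v1_V_bridge`: `A ≤ 1/2`, `B ≤ 1/20`, `9/2 ≤ P₁ ≤ 9`;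
* `InCone_thetaTri_v1_V_big`: every star with `P₁ ≥ 9/2` (`B ≤ 4/81 < 1/20` from `P₁² B ≤ 1`);
* **`InCone_thetaTri_v1_V_main`**: every star with `m ≥ 2` leaves satisfying `A ≥ 1/2`, or `P₁ ≥ 9/2`, or `B ≤ 1/2` with
  (`P₁ ≥ 6/5` or `A > 1/20`) — i.e. every star outside the TINY-LEAF regimes `B > 1/2` (then `P₁ < √2`) and
  `A ≤ 1/20 ∧ B ≤ 1/2 ∧ P₁ < 6/5`, which remain open.
-/

namespace PercRepro

namespace RelaxedTriangle

open TreeClosure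

/-- **THE BRIDGE**: `A ≤ 1/2`, `B ≤ 1/20`, `9/2 ≤ P₁ ≤ 9`. -/
theorem InCone_thetaTri_v1_V_bridge {m : ℕ} (a : Fin (m + 2) → ℝ) (ha : ∀ i, 0 ≤ a i ∧ a i ≤ 1)
    (hA : ∏ i, a i ≤ 1 / 2) (hB : ∏ i, (1 - a i) ≤ 1 / 20)
    (hP : (9 / 2 : ℝ) ≤ ∏ i, (1 + a i ^ 2) ∧ ∏ i, (1 + a i ^ 2) ≤ 9) :
    InCone (thetaTri (v 1) (V a)) := by
  obtain ⟨hA0, _⟩ := prod_unit_mem a ha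
  obtain ⟨hB0, _⟩ := prod_unit_mem (fun i => 1 - a i) (fun i => ⟨by linarith [(ha i).2], by linarith [(ha i).1]⟩)
  rcases le_or_gt (∏ i, a i) (1 / 20) with h1 | h1
  · exact InCone_thetaTri_v1_V_bridge0 a ha ⟨hA0, h1⟩ ⟨hB0, hB⟩ hP
  rcases le_or_gt (∏ i, a i) (3 / 20) with h2 | h2
  · exact InCone_thetaTri_v1_V_bridge1 a ha ⟨h1.le, h2⟩ ⟨hB0, hB⟩ ⟨hP.1, by linarith [hP.2]⟩
  rcases le_or_gt (∏ i, a i) (3 / 10) with h3 | h3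
  · exact InCone_thetaTri_v1_V_bridge2 a ha ⟨h2.le, h3⟩ ⟨hB0, hB⟩ ⟨hP.1, by linarith [hP.2]⟩
  rcases le_or_gt (∏ i, (1 + a i ^ 2)) 8 with h8 | h8
  · exact InCone_thetaTri_v1_V_bridge3a a ha ⟨h3.le, hA⟩ ⟨hB0, hB⟩ ⟨hP.1, h8⟩
  · exact InCone_thetaTri_v1_V_bridgecrown a ha ⟨h3.le, hA⟩ ⟨h8.le, by linarith [hP.2]⟩

/-- **EVERY STAR WITH `P₁ ≥ 9/2`** is in the cone: the crown for `A ≥ 1/2`, the tail for `P₁ ≥ 9`, the bridge between. -/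
theorem InCone_thetaTri_v1_V_big {m : ℕ} (a : Fin (m + 2) → ℝ) (ha : ∀ i, 0 ≤ a i ∧ a i ≤ 1)
    (hP : (9 / 2 : ℝ) ≤ ∏ i, (1 + a i ^ 2)) : InCone (thetaTri (v 1) (V a)) := by
  rcases le_or_gt (1 / 2) (∏ i, a i) with hA | hA
  · exact InCone_thetaTri_v1_V_crown a ha hA
  rcases le_or_gt 9 (∏ i, (1 + a i ^ 2)) with h10 | h10
  · exact InCone_thetaTri_v1_V_tail9 a ha hA.le h10
  have hu1 := prod_one_add_sq_sq_mul_prod_one_sub_le_one a ha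
  obtain ⟨hB0, _⟩ := prod_unit_mem (fun i => 1 - a i) (fun i => ⟨by linarith [(ha i).2], by linarith [(ha i).1]⟩)
  have hB : ∏ i, (1 - a i) ≤ 1 / 20 := by
    have hsq : (81 / 4 : ℝ) ≤ (∏ i, (1 + a i ^ 2)) ^ 2 := by nlinarith
    nlinarith [mul_le_mul_of_nonneg_right hsq hB0]
  exact InCone_thetaTri_v1_V_bridge a ha hA.le hB ⟨hP, h10.le⟩

/-- **THE STATE OF THE LAST SEED.** Every star with `m ≥ 2` leaves in `[0, 1]` satisfying `A ≥ 1/2`, or `P₁ ≥ 9/2`, or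
`B ≤ 1/2` together with (`P₁ ≥ 6/5` or `A > 1/20`) has `θ_△(v 1, V a) ∈ cone`. -/
theorem InCone_thetaTri_v1_V_main {m : ℕ} (a : Fin (m + 2) → ℝ) (ha : ∀ i, 0 ≤ a i ∧ a i ≤ 1)
    (h : 1 / 2 ≤ ∏ i, a i ∨ (9 / 2 : ℝ) ≤ ∏ i, (1 + a i ^ 2)
      ∨ (∏ i, (1 - a i) ≤ 1 / 2 ∧ ((6 / 5 : ℝ) ≤ ∏ i, (1 + a i ^ 2) ∨ 1 / 20 < ∏ i, a i))) :
    InCone (thetaTri (v 1) (V a)) := by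
  rcases h with hA | hP | ⟨hB, hrest⟩
  · exact InCone_thetaTri_v1_V_crown a ha hA
  · exact InCone_thetaTri_v1_V_big a ha hP
  rcases le_or_gt (1 / 2) (∏ i, a i) with hA | hA
  · exact InCone_thetaTri_v1_V_crown a ha hA
  rcases le_or_gt (9 / 2) (∏ i, (1 + a i ^ 2)) with hP | hP
  · exact InCone_thetaTri_v1_V_big a ha hP
  rcases hrest with h65 | hA20
  · exact InCone_thetaTri_v1_V_half_full a ha hA.le hB ⟨h65, hP.le⟩
  · exact InCone_thetaTri_v1_V_half_all a ha hA.le hB hP.le (fun h => absurd hA20 (not_lt.mpr h))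

end RelaxedTriangle

end PercRepro
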